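import Mathlib
import Literature.Computability.AlgebraicComplexity.SymmetricDetRepresentationProofs
import Literature.Computability.AlgebraicComplexity.LRPencilOfMatrix
import Literature.Computability.AlgebraicComplexity.TavenasHutchinsonFamily

/-!
# Route SymmetroidDescartes — support `ThetaPencilWitness` (stmt-ValiantsHypothesis-18502), part 1:
symmetric pencils out of affine symmetric matrices, and the alternation points of Tavenas' `V_ν`

Helper file for `Summit.ValiantsHypothesis.ValiantsHypothesis.Theses.SymmetroidDescartes.ThetaPencilWitness`.
Three self-contained tools of the witness construction:

* `hasSymmAffineDetRepr_of_hasDetRepr` — over any field with `2 ≠ 0`, an affine determinantal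
  representation of size `m` gives a SYMMETRIC affine one of size `4m³ + 7`
  (Grenet–Kaltofen–Koiran–Portier 2011, Thm. 5 = the tree theorem
  `GKKP2011_detPoly_symmetric_holds`, composed with the substitution `x_{ij} ↦ A i j`; this is the
  proof of `Theorems/SymPencilSdcOfDc.lean`, there written over `ℂ`, verbatim over a general field);
* `exists_symm_pencil_eval` — a symmetric matrix `B` of affine linear forms in `y_0, …, y_{n-1}`
  restricted to a monomial curve `y_i := t^{e_i}` is a lacunary symmetric pencil
  `∑_{l ≤ n} t^{d_l} S_l` (`S_0 = B(0)`, `S_{i+1}` = coefficient matrix of `y_i`, `d_0 = 0`,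
  `d_{i+1} = e_i`) with `det (∑ t^{d_l} S_l) = (det B)(t^{e})` for every real `t`, in exactly the
  currency of the route (`((∑ l, X ^ d l • (S l).map C).det).eval t`);
* `tavenasV_alternates` — at the positive, strictly increasing points `t_u = 4^{2u+1}/4^{2^ν}`
  (`= -xPt (2^ν) u` of `TavenasHutchinsonFamily.lean`) consecutive values `V_ν(-t_u)`,
  `V_ν(-t_{u+1})` have opposite signs (`sign_eval_xPt`).

References: [GrenetEtAl2011] Thm. 5; [Tavenas2014] Lemme 3.36.
-/

noncomputable section

-- single-conjunct layout: Sub = Summit, duplicated namespace component intended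
set_option linter.dupNamespace false

namespace Summit.ValiantsHypothesis.ValiantsHypothesis.Theorems.SymmetroidDescartes

open MvPolynomial Literature.Computability.AlgebraicComplexity

/-! ### Symmetric affine determinantal representations over a field with `2 ≠ 0` -/

/-- **Symmetrisation of an affine determinantal representation** (Grenet–Kaltofen–Koiran–Portier
2011, Thm. 5, composed with substitution): over a field `k` with `(2 : k) ≠ 0`, if `f = det A`
for an `m × m` matrix of affine linear forms then `f = det B` for a SYMMETRIC `(4m³+7) × (4m³+7)`
matrix of affine linear forms — substitute `A i j` for `x_{ij}` in the symmetric matrix `M` with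
`det M = DET_m` of `GKKP2011_detPoly_symmetric_holds`. [cite: GrenetEtAl2011, Thm 5] -/
theorem hasSymmAffineDetRepr_of_hasDetRepr {k : Type} [Field k] (h2 : (2 : k) ≠ 0)
    {N : Type*} {f : MvPolynomial N k} {m : ℕ} (hf : HasDetRepr f m) :
    ∃ B : Matrix (Fin (4 * m ^ 3 + 7)) (Fin (4 * m ^ 3 + 7)) (MvPolynomial N k),
      B.IsSymm ∧ IsAffineDetRepr f B := by
  obtain ⟨A, hAdeg, hAdet⟩ := hf
  obtain ⟨M, hMsymm, hMentry, hMdet⟩ := GKKP2011_detPoly_symmetric_holds k h2 m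
  -- the substitution `x_{ij} ↦ A i j`
  let φ : MvPolynomial (Fin m × Fin m) k →ₐ[k] MvPolynomial N k := aeval fun p => A p.1 p.2
  refine ⟨M.map φ, hMsymm.map φ, ?_, ?_⟩
  · intro a b
    rw [Matrix.map_apply]
    rcases hMentry a b with ⟨ij, hij⟩ | h0 | h1 | hm1 | hC
    · rw [hij]
      simpa only [φ, aeval_X] using hAdeg ij.1 ij.2
    · rw [h0, map_zero, totalDegree_zero]
      exact Nat.zero_le _
    · rw [h1, map_one, totalDegree_one]
      exact Nat.zero_le _
    · rw [hm1, map_neg, map_one, totalDegree_neg, totalDegree_one]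
      exact Nat.zero_le _
    · rw [hC]
      simp only [φ, aeval_C, algebraMap_eq, totalDegree_C]
      exact Nat.zero_le _
  · have hmap : (M.map φ).det = φ M.det := (AlgHom.map_det φ M).symm
    rw [hmap, hMdet, detPoly, AlgHom.map_det, Matrix.mvPolynomialX_mapMatrix_aeval k A, hAdet]

/-! ### From an affine symmetric matrix to a lacunary symmetric pencil -/

/-- **Pencil of an affine symmetric matrix on a monomial curve.** For a symmetric `m × m` matrix
`B` of affine linear forms in `y_0, …, y_{n-1}` over `ℝ` and exponents `e : Fin n → ℕ` there are
real symmetric matrices `S_0, …, S_n` and exponents `d_0, …, d_n` (namely `S_0 = B(0)`, `d_0 = 0`,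
`S_{i+1} =` the coefficient matrix of `y_i`, `d_{i+1} = e_i`) such that for every real `t` the
pencil determinant `det (∑_l t^{d_l} S_l)` is `det B` evaluated at `y_i := t^{e_i}`. [folklore] -/
theorem exists_symm_pencil_eval {n m : ℕ} (B : Matrix (Fin m) (Fin m) (MvPolynomial (Fin n) ℝ))
    (hB : ∀ a b, (B a b).totalDegree ≤ 1) (hsymm : B.IsSymm) (e : Fin n → ℕ) :
    ∃ (S : Fin (n + 1) → Matrix (Fin m) (Fin m) ℝ) (d : Fin (n + 1) → ℕ), (∀ l, (S l).IsSymm) ∧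
      ∀ t : ℝ, ((∑ l, (Polynomial.X : Polynomial ℝ) ^ d l • (S l).map Polynomial.C).det).eval t =
        MvPolynomial.eval (fun i => t ^ e i) B.det := by
  refine ⟨Fin.cons (constPart B) (fun i => LRPencil.coeffMat B i), Fin.cons 0 e, ?_, ?_⟩
  · refine Fin.cases ?_ (fun i => ?_)
    · rw [Fin.cons_zero]
      exact hsymm.map _
    · rw [Fin.cons_succ]
      exact hsymm.map _
  · intro t
    rw [← Polynomial.coe_evalRingHom, RingHom.map_det, RingHom.map_det, RingHom.mapMatrix_apply,
      RingHom.mapMatrix_apply, LRPencil.map_eval_eq B hB]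
    congr 1
    ext a c
    simp only [Matrix.map_apply, Matrix.sum_apply, Matrix.smul_apply, Matrix.add_apply,
      Polynomial.coe_evalRingHom, smul_eq_mul, Fin.sum_univ_succ, Fin.cons_zero, Fin.cons_succ,
      pow_zero, one_mul, Polynomial.eval_add, Polynomial.eval_finsetSum, Polynomial.eval_mul,
      Polynomial.eval_pow, Polynomial.eval_X, Polynomial.eval_C]

/-! ### The alternation points of `V_ν` on the positive axis -/

/-- **Alternation of `V_ν(-t)` along `t_u = 4^{2u+1}/4^{2^ν}`**: the points `t_u = -x_u`
(`xPt`) are positive and strictly increasing in `u`, and for `u + 1 < 2^ν` the values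
`V_ν(-t_u)`, `V_ν(-t_{u+1})` have opposite signs, since `sign V_ν(x_u) = (-1)^u`
(`sign_eval_xPt`; Tavenas 2014, Lemme 3.36, dominant-term form). [cite: Tavenas2014, Lemme 3.36] -/
theorem tavenasV_alternates (ν : ℕ) :
    (∀ u, 0 < -xPt (2 ^ ν) u) ∧ StrictMono (fun u => -xPt (2 ^ ν) u) ∧
      ∀ u, u + 1 < 2 ^ ν →
        ((tavenasV ν).map (Int.castRingHom ℝ)).eval (-(-xPt (2 ^ ν) u)) *
          ((tavenasV ν).map (Int.castRingHom ℝ)).eval (-(-xPt (2 ^ ν) (u + 1))) < 0 := by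
  refine ⟨fun u => ?_, ?_, fun u hu => ?_⟩
  · unfold xPt
    rw [neg_div, neg_neg]
    positivity
  · exact (strictAnti_nat_of_succ_lt (xPt_succ_lt (2 ^ ν))).neg
  · rw [neg_neg, neg_neg]
    have h0 := sign_eval_xPt ν u (by omega)
    have h1 := sign_eval_xPt ν (u + 1) hu
    rw [pow_succ] at h1
    rcases neg_one_pow_eq_or ℝ u with h | h <;> rw [h] at h0 h1 <;> nlinarith

end Summit.ValiantsHypothesis.ValiantsHypothesis.Theorems.SymmetroidDescartes

end
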